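import Literature.AlgebraicGeometry.Shioda1979.Statement
import Literature.AlgebraicGeometry.Shioda1982.ExceptionalQuadruplesComplete
import Literature.AlgebraicGeometry.HodgeTheory.FermatFourfoldFiveStandardSextuples
import HarnessLib

/-!
# Shioda 1981 (Math. Ann. 258), Appendix: the stable-generation condition `(Q⁴₂₅)` FAILS

Topic `Literature/AlgebraicGeometry/Shioda1981`. A formalisation — statement AND proof — of the Proposition printed in the Appendix
"A Counterexample to the Condition (Pⁿₘ)" of T. Shioda, *Algebraic Cycles on Abelian Varieties of Fermat Type*, Math. Ann. **258**
(1981) 65–80, pp. 78–79 (text read by the lit seat of cell `pub-hfermat` from the GDZ scan, transcript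
`run/shared/lean/pub/pub-hfermat/lit/Shioda1981-MathAnn258.md`):

> "Let `m = 25`. In this case, it can be shown that there are no indecomposable elements of `Mₘ` in `Mₘ(2)` but that there are 4
> indecomposable elements in `Mₘ(3)`. The latter correspond to the 4 elements of `𝔅⁴₂₅` (A.1) `γᵢ = (i, i+5, i+10, i+15, i+20, 25−5i)`
> (`i = 1,2,3,4`) … each `ξᵢ = ξ(γᵢ)` is *not* semi-decomposable … Therefore the sub-semigroup `M'ₘ` of `Mₘ` generated by `Mₘ(1)`,
> `Mₘ(2)` and semi-decomposable elements of `Mₘ(3)` is the same as one generated by `Mₘ(1)` in case `m = 25`. We claim that each `ξᵢ`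
> (`1 ≤ i ≤ 4`) cannot be expressed as `ξᵢ = ξ' − ξ''` for any `ξ', ξ'' ∈ M'ₘ`. … **Proposition.** For `m = 25` and `n = 4`, the
> condition `(Qⁿₘ)` is not satisfied, and therefore, the conditions `(Pⁿₘ)` or `(Pₘ)` (in the sense of [12] or [13]) are not
> satisfied either." — "The geometric meaning of this result is that the Hodge Conjecture for `X⁴₂₅` … cannot be proven by our method."

(`[12]` = [Shioda1979HodgeFermat], whose §4 p. 183 defines `M'ₘ` and `(Qⁿₘ)` — tree: `Shioda1979.primeGenerators`, `Shioda1979.MPrime`,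
`Shioda1979.ConditionQ`; `[13]` = [Shioda1979PJA].)

## What is proved, and how (the printed argument, with the invariant made explicit)

Shioda's proof has two steps: (1) at `m = 25` every generator of `M'₂₅` is a sum of pairs (no indecomposable element of `M₂₅(2)`;
every semi-decomposable element of `M₂₅(3)` is decomposable), so `M'₂₅ = ⟨M₂₅(1)⟩`; (2) `ξ(γ₁)` is not a difference of two elements of
`⟨M₂₅(1)⟩` (a shortest-relation argument). We run step (1) as two kernel enumerations and replace the shortest-relation argument of
step (2) by the invariant it protects: an element of `⟨Mₘ(1)⟩` has SYMMETRIC multiplicities, `x_ν = x_{m−ν}` (`IsSymmetric`), a property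
preserved by sums and cancellable, while `γ₁ = {1, 6, 11, 16, 21, 20}` has `x₁ = 1 ≠ 0 = x₂₄`.

* `IsSymmetric s` (`∀ x, count x s = count (−x) s`) with `zero`/`add`/`of_add_right`/pair lemmas;
* `hodgeFour_symmetric_twentyfive`: every Hodge `4`-multiset over `ℤ/25` is symmetric ("no indecomposable elements of `M₂₅` in `M₂₅(2)`",
  i.e. every Hodge class of the Fermat surface of degree `25` is a sum of two pairs) — kernel enumeration `checkFour` over the representatives, Hodge test in `ℕ`;
* `semi_symmetric_twentyfive`: every semi-decomposable Hodge sextuple `{a, b, −a−b, c, d, −c−d}` over `ℤ/25` is symmetric — kernel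
  enumeration `checkSix` over sorted representatives (`a ≤ b`, `a ≤ c ≤ d`), Hodge test in `ℕ`, the general case by swapping;
* `mPrime_symmetric_twentyfive`: hence every element of `M'₂₅` is symmetric (`AddSubmonoid.closure_induction`);
* **`not_conditionQ_twentyfive_four : ¬ Shioda1979.ConditionQ 25 4`** — the Proposition; `not_conditionQAll_twentyfive : ¬ ConditionQAll 25`;
  and "therefore" `not_conditionP_twentyfive_four : ¬ Shioda1979.ConditionP 25 4`, `not_conditionPAll_twentyfive` (via the tree's
  `(P) ⇒ (Q)`, `Shioda1979.conditionQ_of_conditionP`). The Proc. Japan Acad. form `¬ ShiodaConditionUpTo 25 4` is already the tree's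
  `FermatCharacter.not_shiodaConditionUpTo_twentyfive_four` (sibling file `FermatFourfoldFiveStandardSextuples`; it also follows from
  `not_conditionQ_twentyfive_four` by `Shioda1979.conditionQ_of_shiodaConditionUpTo`).

No named fact; everything is proved. Nothing here concerns the truth of the Hodge conjecture for `X⁴₂₅` (which holds: [Aoki1987, Cor. 2-3];
Shioda 1983 "Added in proof" (v)) — only the reach of the 1979 method, exactly as printed.

## References
* [Shioda1981FermatType] T. Shioda, Math. Ann. 258 (1981) 65–80, Appendix pp. 78–79 (Proposition; (A.1)).
* [Shioda1979HodgeFermat] T. Shioda, Math. Ann. 245 (1979), §3 p. 180 (`(Pⁿₘ)`), §4 p. 183 (`M'ₘ`, `(Qⁿₘ)`).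
* [Shioda1979PJA] T. Shioda, Proc. Japan Acad. 55A (1979) §1.
* [Aoki1987] N. Aoki, J. Math. Soc. Japan 39 (1987), Cor. 2-3.
-/

namespace Literature.AlgebraicGeometry.Shioda1981

open Multiset
open Literature.AlgebraicGeometry.HodgeTheory Literature.AlgebraicGeometry.HodgeTheory.FermatCharacter
open Literature.AlgebraicGeometry.Shioda1979 Literature.AlgebraicGeometry.Shioda1982

variable {m : ℕ}

/-! ### Symmetric multiplicities: the invariant of `⟨Mₘ(1)⟩` -/

/-- **Symmetric multiplicities** `x_ν = x_{m−ν}` for all `ν`: the shape of every element of the semigroup generated by `Mₘ(1)` (the pairs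
`{a, −a}`), hence — Shioda, Appendix p. 79, at `m = 25` — of every element of `M'₂₅ = ⟨M₂₅(1)⟩`.
[cite: Shioda1981FermatType, Appendix pp. 78–79] [cite: Shioda1979HodgeFermat, §3 p. 180 (Mₘ(1))] -/
def IsSymmetric (s : Multiset (ZMod m)) : Prop := ∀ x : ZMod m, s.count x = s.count (-x)

/-- `0` is symmetric. [folklore] -/
private theorem IsSymmetric.zero : IsSymmetric (0 : Multiset (ZMod m)) := fun x ↦ by simp

/-- Sums of symmetric multisets are symmetric. [folklore] -/
private theorem IsSymmetric.add {s t : Multiset (ZMod m)} (hs : IsSymmetric s) (ht : IsSymmetric t) : IsSymmetric (s + t) :=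
  fun x ↦ by rw [count_add, count_add, hs x, ht x]

/-- Cancellation: `s + t` and `t` symmetric ⇒ `s` symmetric. [folklore] -/
private theorem IsSymmetric.of_add_right {s t : Multiset (ZMod m)} (hst : IsSymmetric (s + t)) (ht : IsSymmetric t) : IsSymmetric s :=
  fun x ↦ by have h := hst x; rw [count_add, count_add, ht x] at h; omega

/-- A pair `{a, −a}` is symmetric. [cite: Shioda1979HodgeFermat, §3 p. 180 (Mₘ(1))] -/
private theorem isSymmetric_pair (a : ZMod m) : IsSymmetric ({a, -a} : Multiset (ZMod m)) := by
  intro x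
  simp only [insert_eq_cons, count_cons, count_singleton, neg_eq_iff_eq_neg, neg_neg]
  exact Nat.add_comm _ _

/-! ### Step (1) at `m = 25`: the generators of `M'₂₅` are symmetric (kernel enumerations) -/

/-- Symmetry as a Boolean over the representatives `0, …, 24`. [folklore] -/
private def symB (s : Multiset (ZMod 25)) : Bool :=
  (List.range 25).all fun x ↦ s.count (x : ZMod 25) == s.count (-(x : ZMod 25))

/-- `symB` decides `IsSymmetric`. [folklore] -/
private theorem isSymmetric_of_symB {s : Multiset (ZMod 25)} (h : symB s = true) : IsSymmetric s := by
  unfold symB at h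
  simp only [List.all_eq_true, List.mem_range, beq_iff_eq] at h
  intro x
  have := h x.val (ZMod.val_lt x)
  rwa [ZMod.natCast_zmod_val] at this

/-- Representative of `−(a+b)`. [folklore] -/
private theorem val_neg_add_two (a b : ZMod 25) : (-(a + b)).val = (50 - (a.val + b.val)) % 25 := by
  revert a b; decide

/-- Representative of `−(a+b+c)`. [folklore] -/
private theorem val_neg_add_three (a b c : ZMod 25) : (-(a + b + c)).val = (75 - (a.val + b.val + c.val)) % 25 := by
  revert a b c; decide

/-- Shioda's Hodge test (eqs. (2)–(3)) for the `4`-tuple of representatives `(a, b, c, −(a+b+c))`, in `ℕ` arithmetic over `unitsList 25`.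
[cite: Shioda1979PJA, §1 eqs. (2), (3)] -/
private def hodgeFourN (a b c : ℕ) : Bool :=
  (a != 0 && b != 0 && c != 0 && (75 - (a + b + c)) % 25 != 0) &&
    (unitsList 25).all fun t ↦ t * a % 25 + t * b % 25 + t * c % 25 + t * ((75 - (a + b + c)) % 25) % 25 == 50

/-- Shioda's Hodge test for the sextuple of representatives `(a, b, −(a+b), c, d, −(c+d))`, in `ℕ` arithmetic over `unitsList 25`.
[cite: Shioda1979PJA, §1 eqs. (2), (3)] -/
private def hodgeSixN (a b c d : ℕ) : Bool :=
  (a != 0 && b != 0 && (50 - (a + b)) % 25 != 0 && c != 0 && d != 0 && (50 - (c + d)) % 25 != 0) &&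
    (unitsList 25).all fun t ↦
      t * a % 25 + t * b % 25 + t * ((50 - (a + b)) % 25) % 25 + t * c % 25 + t * d % 25 + t * ((50 - (c + d)) % 25) % 25 == 75

/-- A Hodge `4`-multiset `{a, b, c, −(a+b+c)}` passes `hodgeFourN` on its representatives. [cite: Shioda1979PJA, §1 eqs. (2), (3)] -/
private theorem hodgeFourN_of_isHodgeMultiset (a b c : ZMod 25)
    (h : IsHodgeMultiset ({a, b, c, -(a + b + c)} : Multiset (ZMod 25))) : hodgeFourN a.val b.val c.val = true := by
  have hv := val_neg_add_three a b c
  rw [isHodgeMultiset_iff_unitsList] at h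
  obtain ⟨⟨h0, -⟩, hall⟩ := h
  have ha : a.val ≠ 0 := fun e ↦ h0 a (by simp) ((ZMod.val_eq_zero a).mp e)
  have hb : b.val ≠ 0 := fun e ↦ h0 b (by simp) ((ZMod.val_eq_zero b).mp e)
  have hc : c.val ≠ 0 := fun e ↦ h0 c (by simp) ((ZMod.val_eq_zero c).mp e)
  have hd : (-(a + b + c)).val ≠ 0 := fun e ↦ h0 (-(a + b + c)) (by simp) ((ZMod.val_eq_zero _).mp e)
  rw [hv] at hd
  unfold hodgeFourN
  simp only [Bool.and_eq_true, bne_iff_ne, ne_eq, List.all_eq_true, beq_iff_eq]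
  refine ⟨⟨⟨⟨ha, hb⟩, hc⟩, hd⟩, fun t ht ↦ ?_⟩
  have := hall t ht
  simp only [Multiset.insert_eq_cons, Multiset.map_cons, Multiset.map_singleton, Multiset.sum_cons, Multiset.sum_singleton,
    Multiset.card_cons, Multiset.card_singleton, hv] at this
  omega

/-- A Hodge sextuple `{a, b, −(a+b), c, d, −(c+d)}` passes `hodgeSixN` on its representatives. [cite: Shioda1979PJA, §1 eqs. (2), (3)] -/
private theorem hodgeSixN_of_isHodgeMultiset (a b c d : ZMod 25)
    (h : IsHodgeMultiset ({a, b, -(a + b), c, d, -(c + d)} : Multiset (ZMod 25))) :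
    hodgeSixN a.val b.val c.val d.val = true := by
  have hx := val_neg_add_two a b
  have hy := val_neg_add_two c d
  rw [isHodgeMultiset_iff_unitsList] at h
  obtain ⟨⟨h0, -⟩, hall⟩ := h
  have ha : a.val ≠ 0 := fun e ↦ h0 a (by simp) ((ZMod.val_eq_zero a).mp e)
  have hb : b.val ≠ 0 := fun e ↦ h0 b (by simp) ((ZMod.val_eq_zero b).mp e)
  have hc : c.val ≠ 0 := fun e ↦ h0 c (by simp) ((ZMod.val_eq_zero c).mp e)
  have hd : d.val ≠ 0 := fun e ↦ h0 d (by simp) ((ZMod.val_eq_zero d).mp e)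
  have hx0 : (-(a + b)).val ≠ 0 := fun e ↦ h0 (-(a + b)) (by simp) ((ZMod.val_eq_zero _).mp e)
  have hy0 : (-(c + d)).val ≠ 0 := fun e ↦ h0 (-(c + d)) (by simp) ((ZMod.val_eq_zero _).mp e)
  rw [hx] at hx0
  rw [hy] at hy0
  unfold hodgeSixN
  simp only [Bool.and_eq_true, bne_iff_ne, ne_eq, List.all_eq_true, beq_iff_eq]
  refine ⟨⟨⟨⟨⟨⟨ha, hb⟩, hx0⟩, hc⟩, hd⟩, hy0⟩, fun t ht ↦ ?_⟩
  have := hall t ht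
  simp only [Multiset.insert_eq_cons, Multiset.map_cons, Multiset.map_singleton, Multiset.sum_cons, Multiset.sum_singleton,
    Multiset.card_cons, Multiset.card_singleton, hx, hy] at this
  omega

/-- Kernel enumeration over `(ℤ/25)³`: every Hodge `4`-multiset `{a, b, c, −(a+b+c)}` is symmetric (the symmetry test runs only on the
Hodge survivors). [cite: Shioda1981FermatType, Appendix p. 78] -/
private def checkFour : Bool :=
  (List.range 25).all fun a ↦ (List.range 25).all fun b ↦ (List.range 25).all fun c ↦
    !(hodgeFourN a b c) ||
      symB {(a : ZMod 25), (b : ZMod 25), (c : ZMod 25), -((a : ZMod 25) + (b : ZMod 25) + (c : ZMod 25))}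

set_option maxHeartbeats 0 in
/-- `checkFour` passes. Kernel. [cite: Shioda1981FermatType, Appendix p. 78] -/
private theorem checkFour_true : checkFour = true := by decide +kernel

/-- Kernel enumeration for fixed `a` over `b ≥ a`, `c ≥ a`, `d ≥ c`: every Hodge sextuple `{a, b, −(a+b), c, d, −(c+d)}` (juxtaposition
of two zero-sum triples) is symmetric. [cite: Shioda1981FermatType, Appendix p. 78] -/
private def checkSix (a : ℕ) : Bool :=
  (List.range' a (25 - a)).all fun b ↦ (List.range' a (25 - a)).all fun c ↦ (List.range' c (25 - c)).all fun d ↦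
    !(hodgeSixN a b c d) ||
      symB {(a : ZMod 25), (b : ZMod 25), -((a : ZMod 25) + (b : ZMod 25)), (c : ZMod 25), (d : ZMod 25), -((c : ZMod 25) + (d : ZMod 25))}

set_option maxHeartbeats 0 in
/-- `checkSix a` passes for every `a < 25`. Kernel. [cite: Shioda1981FermatType, Appendix p. 78] -/
private theorem checkSix_true : ∀ a ∈ List.range 25, checkSix a = true := by
  decide +kernel

/-- **"There are no indecomposable elements of `M₂₅` in `M₂₅(2)`"** in the form used: every Hodge `4`-multiset over `ℤ/25` (Hodge class
of the Fermat surface of degree `25`) has symmetric multiplicities. [cite: Shioda1981FermatType, Appendix p. 78] -/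
theorem hodgeFour_symmetric_twentyfive (a b c : ZMod 25)
    (h : IsHodgeMultiset ({a, b, c, -(a + b + c)} : Multiset (ZMod 25))) :
    IsSymmetric ({a, b, c, -(a + b + c)} : Multiset (ZMod 25)) := by
  have hc := checkFour_true
  unfold checkFour at hc
  rw [List.all_eq_true] at hc
  have ha := hc a.val (List.mem_range.mpr (ZMod.val_lt a))
  rw [List.all_eq_true] at ha
  have hb := ha b.val (List.mem_range.mpr (ZMod.val_lt b))
  rw [List.all_eq_true] at hb
  have habc := hb c.val (List.mem_range.mpr (ZMod.val_lt c))
  simp only [ZMod.natCast_zmod_val, Bool.or_eq_true, Bool.not_eq_true'] at habc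
  rcases habc with habc | habc
  · rw [hodgeFourN_of_isHodgeMultiset a b c h] at habc; exact absurd habc (by decide)
  · exact isSymmetric_of_symB habc

/-- The sorted case of `semi_symmetric_twentyfive`. [cite: Shioda1981FermatType, Appendix pp. 78–79] -/
private theorem semi_symmetric_sorted (a b c d : ZMod 25) (hab : a.val ≤ b.val) (hac : a.val ≤ c.val) (hcd : c.val ≤ d.val)
    (h : IsHodgeMultiset ({a, b, -(a + b), c, d, -(c + d)} : Multiset (ZMod 25))) :
    IsSymmetric ({a, b, -(a + b), c, d, -(c + d)} : Multiset (ZMod 25)) := by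
  have ha := checkSix_true a.val (List.mem_range.mpr (ZMod.val_lt a))
  unfold checkSix at ha
  rw [List.all_eq_true] at ha
  have hbv := ZMod.val_lt b
  have hcv := ZMod.val_lt c
  have hdv := ZMod.val_lt d
  have hb := ha b.val (List.mem_range'_1.mpr ⟨hab, by omega⟩)
  rw [List.all_eq_true] at hb
  have hc := hb c.val (List.mem_range'_1.mpr ⟨hac, by omega⟩)
  rw [List.all_eq_true] at hc
  have hd := hc d.val (List.mem_range'_1.mpr ⟨hcd, by omega⟩)
  simp only [ZMod.natCast_zmod_val, Bool.or_eq_true, Bool.not_eq_true'] at hd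
  rcases hd with hd | hd
  · rw [hodgeSixN_of_isHodgeMultiset a b c d h] at hd; exact absurd hd (by decide)
  · exact isSymmetric_of_symB hd

/-- The sum-of-triples form, sorted inside the triples. [folklore] -/
private theorem semi_symmetric_halfsorted (a b c d : ZMod 25) (hab : a.val ≤ b.val) (hcd : c.val ≤ d.val)
    (h : IsHodgeMultiset (({a, b, -(a + b)} : Multiset (ZMod 25)) + {c, d, -(c + d)})) :
    IsSymmetric (({a, b, -(a + b)} : Multiset (ZMod 25)) + {c, d, -(c + d)}) := by
  rcases le_total a.val c.val with hac | hca
  · have heq : (({a, b, -(a + b)} : Multiset (ZMod 25)) + {c, d, -(c + d)}) = {a, b, -(a + b), c, d, -(c + d)} := by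
      simp only [insert_eq_cons, ← singleton_add]; abel
    rw [heq] at h ⊢
    exact semi_symmetric_sorted a b c d hab hac hcd h
  · have heq : (({a, b, -(a + b)} : Multiset (ZMod 25)) + {c, d, -(c + d)}) = {c, d, -(c + d), a, b, -(a + b)} := by
      simp only [insert_eq_cons, ← singleton_add]; abel
    rw [heq] at h ⊢
    exact semi_symmetric_sorted c d a b hcd hca hab h

/-- **Every semi-decomposable element of `M₂₅(3)` has the shape of a sum of pairs**: a Hodge sextuple over `ℤ/25` that is the juxtaposition of
two zero-sum triples has symmetric multiplicities. [cite: Shioda1981FermatType, Appendix pp. 78–79] -/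
theorem semi_symmetric_twentyfive (a b c d : ZMod 25)
    (h : IsHodgeMultiset (({a, b, -(a + b)} : Multiset (ZMod 25)) + {c, d, -(c + d)})) :
    IsSymmetric (({a, b, -(a + b)} : Multiset (ZMod 25)) + {c, d, -(c + d)}) := by
  have hswap : ∀ x y : ZMod 25, ({x, y, -(x + y)} : Multiset (ZMod 25)) = {y, x, -(y + x)} := by
    intro x y; rw [add_comm y x]; simp [insert_eq_cons, cons_swap]
  rcases le_total a.val b.val with hab | hba <;> rcases le_total c.val d.val with hcd | hdc
  · exact semi_symmetric_halfsorted a b c d hab hcd h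
  · rw [hswap c d] at h ⊢; exact semi_symmetric_halfsorted a b d c hab hdc h
  · rw [hswap a b] at h ⊢; exact semi_symmetric_halfsorted b a c d hba hcd h
  · rw [hswap a b, hswap c d] at h ⊢; exact semi_symmetric_halfsorted b a d c hba hdc h

/-- Step (1): **every generator of `M'₂₅` is symmetric** (pairs; Hodge `4`-sets; semi-decomposable Hodge sextuples), i.e.
"`M'ₘ` … is the same as one generated by `Mₘ(1)` in case `m = 25`" in the invariant form. [cite: Shioda1981FermatType, Appendix pp. 78–79] -/
theorem primeGenerators_symmetric_twentyfive : ∀ g ∈ primeGenerators 25, IsSymmetric g := by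
  rintro g ⟨hg, h2 | h4 | ⟨-, t, u, ht3, hu3, hts, hus, rfl⟩⟩
  · obtain ⟨a, -, rfl⟩ := hg.eq_pair_of_card_eq_two h2
    exact isSymmetric_pair a
  · obtain ⟨a, b, c, d, rfl⟩ := Multiset.card_eq_four.mp h4
    have hd : d = -(a + b + c) := by
      have h0 := hg.1.2
      simp only [insert_eq_cons, sum_cons, sum_singleton] at h0
      linear_combination h0
    subst hd
    exact hodgeFour_symmetric_twentyfive a b c hg
  · obtain ⟨a, b, x, rfl⟩ := Multiset.card_eq_three.mp ht3
    obtain ⟨c, d, y, rfl⟩ := Multiset.card_eq_three.mp hu3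
    have hx : x = -(a + b) := by
      simp only [insert_eq_cons, sum_cons, sum_singleton] at hts; linear_combination hts
    have hy : y = -(c + d) := by
      simp only [insert_eq_cons, sum_cons, sum_singleton] at hus; linear_combination hus
    subst hx hy
    exact semi_symmetric_twentyfive a b c d hg

/-- Hence **every element of `M'₂₅` is symmetric**. [cite: Shioda1981FermatType, Appendix p. 79] -/
theorem mPrime_symmetric_twentyfive : ∀ ξ ∈ MPrime 25, IsSymmetric ξ := by
  intro ξ hξ
  induction hξ using AddSubmonoid.closure_induction with
  | mem x hx => exact primeGenerators_symmetric_twentyfive x hx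
  | zero => exact IsSymmetric.zero
  | add x y _ _ hx hy => exact hx.add hy

/-! ### Step (2): `γ₁` is not a difference of two elements of `M'₂₅` — the Proposition -/

/-- `γ₁ = (1, 6, 11, 16, 21, 20)` of (A.1) has non-symmetric multiplicities (`x₁ = 1`, `x₂₄ = 0`). [cite: Shioda1981FermatType, Appendix (A.1) p. 78] -/
theorem not_isSymmetric_gammaOne : ¬ IsSymmetric ({1, 6, 11, 16, 21, 20} : Multiset (ZMod 25)) := by
  intro h
  have := h 1
  revert this
  decide

/-- **Shioda 1981, Appendix, Proposition (first clause): for `m = 25` and `n = 4` the condition `(Qⁿₘ)` is NOT satisfied** —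
`ξ(γ₁)` is not `ξ' − ξ''` with `ξ', ξ'' ∈ M'₂₅` (both would be symmetric, and symmetry cancels). [cite: Shioda1981FermatType, Appendix Proposition p. 79] -/
theorem not_conditionQ_twentyfive_four : ¬ ConditionQ 25 4 := by
  intro h
  obtain ⟨ξ₁, h₁, ξ₂, h₂, heq⟩ := h _ isHodgeMultiset_fiveStandard_twentyfive (by decide) (by decide)
  have hs : IsSymmetric (({1, 6, 11, 16, 21, 20} : Multiset (ZMod 25)) + ξ₂) := heq ▸ mPrime_symmetric_twentyfive ξ₁ h₁
  exact not_isSymmetric_gammaOne (hs.of_add_right (mPrime_symmetric_twentyfive ξ₂ h₂))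

/-- Hence `(Q₂₅)` (all lengths) fails. [cite: Shioda1981FermatType, Appendix Proposition p. 79] -/
theorem not_conditionQAll_twentyfive : ¬ ConditionQAll 25 := fun h ↦
  not_conditionQ_twentyfive_four (conditionQAll_iff_forall.1 h 4)

/-- **Proposition (second clause), "and therefore the conditions `(Pⁿₘ)` … are not satisfied either"**: the Math. Ann. 245 condition
`(P⁴₂₅)` fails (by `(P) ⇒ (Q)`, [Shioda1979HodgeFermat] §4 p. 183). [cite: Shioda1981FermatType, Appendix Proposition p. 79] -/
theorem not_conditionP_twentyfive_four : ¬ ConditionP 25 4 := fun h ↦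
  not_conditionQ_twentyfive_four (conditionQ_of_conditionP h)

/-- … "or `(Pₘ)`": the Math. Ann. 245 condition `(P₂₅)` fails. [cite: Shioda1981FermatType, Appendix Proposition p. 79] -/
theorem not_conditionPAll_twentyfive : ¬ ConditionPAll 25 := fun h ↦
  not_conditionP_twentyfive_four (conditionPAll_iff_forall.1 h 4)

/-! "(in the sense of [12] or [13])": the Proc. Japan Acad. form `(P⁴₂₅)'` (tree `ShiodaConditionUpTo 25 4`, with the
semi-decomposable alternative) fails as well — by `(P)' ⇒ (Q)` (`Shioda1979.conditionQ_of_shiodaConditionUpTo`) from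
`not_conditionQ_twentyfive_four`; this is the already-landed `FermatCharacter.not_shiodaConditionUpTo_twentyfive_four`
(`HodgeTheory/FermatFourfoldFiveStandardSextuples.lean`), not restated here. -/

end Literature.AlgebraicGeometry.Shioda1981
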